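import Literature.Analysis.Calculus.JacobianNullLagrangian
import Literature.NumberTheory.Transcendental.SemialgebraicLineDeriv

/-!
# `StokesGeneration` (stmt-KontsevichZagierPeriods-3586) — line `fibrewise_stokes`,
# stub `stub_suspension_semialgebraic`

Registered stub K5 (rung 15, change of variables for a face-preserving self-map `Φ` of the closed
cube) of the line `fibrewise_stokes` of the crux `StokesGeneration` (route UnfoldedStokes):
**semialgebraicity of the suspension data.** For a `ℚ`-semialgebraic differentiable map `Φ` and a
`ℚ`-semialgebraic differentiable integrand `h` on an open `U ⊆ ℝᴺ`, the suspension
`F(x, t) = ((1 - t) x + t Φ(x), t)` (`x = z ∘ castSucc`, `t = z last`) and the field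
`G(y) = h(y ∘ castSucc) e_last` have the Piola field `W = adj(DF) (G ∘ F) = piolaField F G`
(`Literature/Analysis/Calculus/JacobianNullLagrangian.lean`). We prove that on
`W' = {z | z ∘ castSucc ∈ U ∧ (F z) ∘ castSucc ∈ U}` (open, and with `W` differentiable there — both
hypotheses, supplied by the sibling stub `stub_suspension_regularity`):

1. `W'` is `ℚ`-semialgebraic — it is `{z ∈ V | F' z ∈ U}` for the `ℚ`-semialgebraic map
   `F' z = (F z) ∘ castSucc` on the `ℚ`-semialgebraic cylinder `V = {z | z ∘ castSucc ∈ U}`, i.e. a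
   coordinate projection of `graph F'|_V ∩ (ℝᴺ⁺¹ × U)` (Tarski–Seidenberg; Bochnak–Coste–Roy 1998,
   Prop. 2.2.7);
2. every component `z ↦ W z j = ∑ᵢ Cᵢⱼ(z) G(F z)ᵢ` is `ℚ`-semialgebraic on `W'`: the entries
   `∂_b F_a` of the Jacobian matrix are partial derivatives of the `ℚ`-semialgebraic differentiable
   components of `F` on the open semialgebraic set `V` (Basu–Pollack–Roy 2006, Prop. 3.22:
   `IsSemialgebraicFunOn.fderiv_apply_single`), the cofactors `Cᵢⱼ` are determinants of row-updated
   Jacobian matrices (`IsSemialgebraicFunOn.matrix_det`), and `G(F z)ᵢ` is `h(F' z)` for `i = last`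
   (composite of semialgebraic maps, Bochnak–Coste–Roy Prop. 2.2.6) and `0` otherwise;
3. every partial derivative `z ↦ ∂ⱼ Wⱼ(z) = fderiv ℝ W z eⱼ j` is `ℚ`-semialgebraic on `W'`
   (Prop. 3.22 again, on the open semialgebraic set `W'`, using
   `fderiv ℝ W z v j = fderiv ℝ (z ↦ W z j) z v` where `W` is differentiable).

References: S. Basu, R. Pollack, M.-F. Roy, *Algorithms in Real Algebraic Geometry* (2006), §2.5
(Thm. 2.76, Prop. 2.83–2.84), §3.5 (Prop. 3.22 and the remark on partial derivatives);
J. Bochnak, M. Coste, M.-F. Roy, *Real Algebraic Geometry* (1998), §2.2 (Prop. 2.2.6–2.2.7), §2.9;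
M. Kontsevich, D. Zagier, *Periods* (2001), §1.2 (rule (2)).
-/

noncomputable section

-- `Summit.KontsevichZagierPeriods.KontsevichZagierPeriods.…` is the tree's mandated layout (single-conjunct summit).
set_option linter.dupNamespace false

namespace Summit.KontsevichZagierPeriods.KontsevichZagierPeriods.Cruxes.StokesGeneration.FibrewiseStokes

open Set MvPolynomial
open Literature.NumberTheory.Transcendental
open Literature.ModelTheory.ExponentialFields (IsSemialgebraic)
open Literature.Analysis.Calculus (jacobianMatrix jacCofactor piolaField)

/-- **Preimages under semialgebraic maps.** If `Φ` is a `ℚ`-semialgebraic map on `U ⊆ ℝᵐ` and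
`T ⊆ ℝⁿ` is `ℚ`-semialgebraic, then `{x ∈ U | Φ x ∈ T}` is `ℚ`-semialgebraic: it is the projection
onto the first `m` coordinates of `graph Φ|ᵤ ∩ (ℝᵐ × T)` (Tarski–Seidenberg,
`IsSemialgebraic.image_castAdd`). [cite: BochnakCosteRoy1998, Prop. 2.2.7] -/
private theorem suspSA_isSemialgebraic_sep_mem {m n : ℕ} {U : Set (Fin m → ℝ)}
    {Φ : (Fin m → ℝ) → (Fin n → ℝ)} {T : Set (Fin n → ℝ)} (hΦsa : IsSemialgebraicMapOn ℚ U Φ)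
    (hT : IsSemialgebraic ℚ T) : IsSemialgebraic ℚ {x | x ∈ U ∧ Φ x ∈ T} := by
  -- adapted from `PlanarSAZylev.teCalc_isSemialgebraic_preimage` (Theorems/SymplecticScissorsPlanarSAZylevStubTeCalc.lean)
  have hW : IsSemialgebraic ℚ
      ({z : Fin (m + n) → ℝ | ∃ x ∈ U, z = Fin.append x (Φ x)} ∩
        (fun z : Fin (m + n) → ℝ => z ∘ Fin.natAdd m) ⁻¹' T) :=
    Literature.ModelTheory.ExponentialFields.IsSemialgebraic.inter hΦsa
      (hT.preimage_comp (Fin.natAdd m))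
  convert hW.image_castAdd using 1
  ext x
  simp only [mem_setOf_eq, mem_image, mem_inter_iff, mem_preimage]
  constructor
  · rintro ⟨hxU, hxT⟩
    refine ⟨Fin.append x (Φ x), ⟨⟨x, hxU, rfl⟩, ?_⟩, ?_⟩
    · convert hxT using 1
      funext j
      simp
    · funext i
      simp
  · rintro ⟨z, ⟨⟨x', hx', rfl⟩, hzT⟩, rfl⟩
    have h1 : (fun i => Fin.append x' (Φ x') (Fin.castAdd n i)) = x' := by
      funext i
      simp
    rw [h1]
    refine ⟨hx', ?_⟩
    convert hzT using 1
    funext j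
    simp

/-- Coordinate functions are `ℚ`-semialgebraic on every `ℚ`-semialgebraic set (they are
polynomials). [cite: BochnakCosteRoy1998, §2.2] -/
private theorem suspSA_apply {m : ℕ} {s : Set (Fin m → ℝ)} (hs : IsSemialgebraic ℚ s) (i : Fin m) :
    IsSemialgebraicFunOn ℚ s (fun x => x i) := by
  simpa using isSemialgebraicFunOn_aeval hs (X i : MvPolynomial (Fin m) ℚ)

/-- **Registered stub `stub_suspension_semialgebraic` (rung 15, K5): semialgebraicity of the
suspension data.** For `ℚ`-semialgebraic differentiable `Φ`, `h` on the open set `U`, with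
`F(x, t) = ((1 - t) x + t Φ x, t)`, `G(y) = h(y ∘ castSucc) e_last`, and given that
`W' = {z ∘ castSucc ∈ U ∧ (F z) ∘ castSucc ∈ U}` is open and the Piola field `W = adj(DF)(G ∘ F)` is
differentiable on `W'`: the set `W'`, the components `Wⱼ` and the partial derivatives `∂ⱼ Wⱼ` are
`ℚ`-semialgebraic on `W'` (graph arithmetic, `IsSemialgebraicFunOn.matrix_det`, composition of
semialgebraic maps, and Basu–Pollack–Roy Prop. 3.22 `IsSemialgebraicFunOn.fderiv_apply_single` for
the Jacobian entries and for `∂ⱼ Wⱼ`). [cite: BasuPollackRoy2006, Prop. 3.22] -/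
theorem stub_suspension_semialgebraic {N : ℕ} (U : Set (Fin N → ℝ)) (hU : IsOpen U)
    (Φ : (Fin N → ℝ) → (Fin N → ℝ)) (h : (Fin N → ℝ) → ℝ)
    (hΦsa : IsSemialgebraicMapOn ℚ U Φ) (hhsa : IsSemialgebraicFunOn ℚ U h)
    (hΦd : DifferentiableOn ℝ Φ U) (hhd : DifferentiableOn ℝ h U)
    (F : (Fin (N + 1) → ℝ) → (Fin (N + 1) → ℝ))
    (hF : F = fun z => Fin.snoc (fun k => (1 - z (Fin.last N)) * z (Fin.castSucc k) +
      z (Fin.last N) * Φ (fun l => z (Fin.castSucc l)) k) (z (Fin.last N)))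
    (G : (Fin (N + 1) → ℝ) → (Fin (N + 1) → ℝ))
    (hG : G = fun y => Pi.single (Fin.last N) (h (fun l => y (Fin.castSucc l))))
    (hW'o : IsOpen {z : Fin (N + 1) → ℝ | (fun l => z (Fin.castSucc l)) ∈ U ∧ (fun l => F z (Fin.castSucc l)) ∈ U})
    (hWd : DifferentiableOn ℝ (piolaField F G)
      {z : Fin (N + 1) → ℝ | (fun l => z (Fin.castSucc l)) ∈ U ∧ (fun l => F z (Fin.castSucc l)) ∈ U}) :
    IsSemialgebraic ℚ {z : Fin (N + 1) → ℝ | (fun l => z (Fin.castSucc l)) ∈ U ∧ (fun l => F z (Fin.castSucc l)) ∈ U} ∧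
    (∀ j, IsSemialgebraicFunOn ℚ
      {z : Fin (N + 1) → ℝ | (fun l => z (Fin.castSucc l)) ∈ U ∧ (fun l => F z (Fin.castSucc l)) ∈ U}
      (fun z => piolaField F G z j)) ∧
    (∀ j, IsSemialgebraicFunOn ℚ
      {z : Fin (N + 1) → ℝ | (fun l => z (Fin.castSucc l)) ∈ U ∧ (fun l => F z (Fin.castSucc l)) ∈ U}
      (fun z => fderiv ℝ (piolaField F G) z (Pi.single j 1) j)) := by
  -- `hhd` belongs to the registered interface; the differentiability it feeds is already the
  -- hypothesis `hWd` (supplied by `stub_suspension_regularity`), so it is acknowledged, not used.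
  have _ := hhd
  set W' : Set (Fin (N + 1) → ℝ) := {z | (fun l => z (Fin.castSucc l)) ∈ U ∧
    (fun l => F z (Fin.castSucc l)) ∈ U} with hW'_def
  -- the open semialgebraic cylinder `V = U × ℝ ⊇ W'` on which `F` lives
  set V : Set (Fin (N + 1) → ℝ) := {z | (fun l => z (Fin.castSucc l)) ∈ U} with hV_def
  have hW'V : W' ⊆ V := fun z hz => hz.1
  have hUsa : IsSemialgebraic ℚ U := IsSemialgebraicFunOn.isSemialgebraic_holds hhsa
  have hVsa : IsSemialgebraic ℚ V := hUsa.preimage_comp Fin.castSucc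
  have hπc : Continuous fun z : Fin (N + 1) → ℝ => fun l => z (Fin.castSucc l) :=
    continuous_pi fun l => continuous_apply _
  have hVo : IsOpen V := hU.preimage hπc
  -- the projection `π z = z ∘ castSucc` is a semialgebraic differentiable map on `V`
  have hπsa : IsSemialgebraicMapOn ℚ V (fun z : Fin (N + 1) → ℝ => fun l => z (Fin.castSucc l)) :=
    IsSemialgebraicMapOn.of_forall hVsa fun l => suspSA_apply hVsa (Fin.castSucc l)
  have hπd : Differentiable ℝ (fun z : Fin (N + 1) → ℝ => fun l => z (Fin.castSucc l)) :=
    differentiable_pi.2 fun l => differentiable_apply (Fin.castSucc l)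
  -- the components of `Φ ∘ π` are semialgebraic and differentiable on `V`
  have hΦVsa : ∀ k, IsSemialgebraicFunOn ℚ V (fun z => Φ (fun l => z (Fin.castSucc l)) k) :=
    fun k => IsSemialgebraicFunOn.comp_isSemialgebraicMapOn_holds
      ((isSemialgebraicMapOn_iff_forall_holds hUsa).mp hΦsa k) hπsa fun z hz => hz
  have hΦVd : ∀ k, ∀ z ∈ V, DifferentiableAt ℝ (fun z => Φ (fun l => z (Fin.castSucc l)) k) z := by
    intro k z hz
    have h1 : DifferentiableAt ℝ Φ (fun l => z (Fin.castSucc l)) :=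
      hΦd.differentiableAt (hU.mem_nhds hz)
    exact (differentiableAt_pi.1 h1 k).comp z (hπd z)
  -- the components of `F`
  have hFcs : ∀ z k, F z (Fin.castSucc k) = (1 - z (Fin.last N)) * z (Fin.castSucc k) +
      z (Fin.last N) * Φ (fun l => z (Fin.castSucc l)) k := by
    intro z k
    simp only [hF, Fin.snoc_castSucc]
  have hFlast : ∀ z, F z (Fin.last N) = z (Fin.last N) := by
    intro z
    simp only [hF, Fin.snoc_last]
  have h1sa : IsSemialgebraicFunOn ℚ V fun _ => (1 : ℝ) := by
    simpa using isSemialgebraicFunOn_const_natCast hVsa 1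
  have hFsa : ∀ a, IsSemialgebraicFunOn ℚ V (fun z => F z a) := by
    intro a
    induction a using Fin.lastCases with
    | last =>
      simp only [hFlast]
      exact suspSA_apply hVsa (Fin.last N)
    | cast k =>
      simp only [hFcs]
      exact ((h1sa.fun_sub (suspSA_apply hVsa (Fin.last N))).fun_mul
        (suspSA_apply hVsa (Fin.castSucc k))).fun_add
          ((suspSA_apply hVsa (Fin.last N)).fun_mul (hΦVsa k))
  have hFd : ∀ z ∈ V, DifferentiableAt ℝ F z := by
    intro z hz
    refine differentiableAt_pi.2 fun a => ?_
    induction a using Fin.lastCases with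
    | last =>
      simp only [hFlast]
      exact differentiableAt_apply (Fin.last N) z
    | cast k =>
      simp only [hFcs]
      exact (((differentiableAt_const _).fun_sub (differentiableAt_apply _ z)).fun_mul
        (differentiableAt_apply _ z)).fun_add ((differentiableAt_apply _ z).fun_mul (hΦVd k z hz))
  -- (1) `W' = {z ∈ V | F' z ∈ U}` is semialgebraic
  have hF'sa : IsSemialgebraicMapOn ℚ V (fun z => fun l => F z (Fin.castSucc l)) :=
    IsSemialgebraicMapOn.of_forall hVsa fun l => hFsa (Fin.castSucc l)
  have hW'sa : IsSemialgebraic ℚ W' := suspSA_isSemialgebraic_sep_mem hF'sa hUsa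
  -- (2) Jacobian entries, cofactors and `h ∘ F'` are semialgebraic
  have hJsa : ∀ a b, IsSemialgebraicFunOn ℚ V (fun z => jacobianMatrix F z a b) := by
    intro a b
    refine ((hFsa a).fderiv_apply_single hVo (fun z hz => differentiableAt_pi.1 (hFd z hz) a)
      b).congr fun z hz => ?_
    show fderiv ℝ (fun z => F z a) z (Pi.single b 1) = jacobianMatrix F z a b
    rw [Literature.Analysis.Calculus.jacobianMatrix_apply, fderiv_apply (hFd z hz) a]
    rfl
  have hCsa : ∀ i j, IsSemialgebraicFunOn ℚ W' (fun z => jacCofactor F i j z) := by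
    intro i j
    simp only [Literature.Analysis.Calculus.jacCofactor_eq_adjugate, Matrix.adjugate_apply]
    refine (IsSemialgebraicFunOn.matrix_det hVsa fun a b => ?_).mono hW'V hW'sa
    by_cases ha : a = i
    · subst ha
      simp only [Matrix.updateRow_self]
      rcases eq_or_ne b j with rfl | hb
      · simpa using isSemialgebraicFunOn_const_natCast hVsa 1
      · simpa [Pi.single_apply, hb] using isSemialgebraicFunOn_const_natCast hVsa 0
    · simp only [Matrix.updateRow_ne ha]
      exact hJsa a b
  have hhF'sa : IsSemialgebraicFunOn ℚ W' (fun z => h (fun l => F z (Fin.castSucc l))) :=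
    IsSemialgebraicFunOn.comp_isSemialgebraicMapOn_holds hhsa (hF'sa.mono hW'V hW'sa)
      fun z hz => hz.2
  have hGF : ∀ z i, G (F z) i =
      if i = Fin.last N then h (fun l => F z (Fin.castSucc l)) else 0 := by
    intro z i
    simp only [hG, Pi.single_apply]
  have h0sa : IsSemialgebraicFunOn ℚ W' fun _ => (0 : ℝ) := by
    simpa using isSemialgebraicFunOn_const_natCast hW'sa 0
  have hPsa : ∀ j, IsSemialgebraicFunOn ℚ W' (fun z => piolaField F G z j) := by
    intro j
    simp only [piolaField, hGF]
    refine IsSemialgebraicFunOn.fun_finsetSum _ hW'sa fun i _ => (hCsa i j).fun_mul ?_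
    by_cases hi : i = Fin.last N
    · simp only [hi, if_true]
      exact hhF'sa
    · simp only [hi, if_false]
      exact h0sa
  -- (3) the partial derivatives `∂ⱼ Wⱼ` on the open semialgebraic set `W'`
  have hPd : ∀ z ∈ W', DifferentiableAt ℝ (piolaField F G) z := fun z hz =>
    hWd.differentiableAt (hW'o.mem_nhds hz)
  have hDsa : ∀ j, IsSemialgebraicFunOn ℚ W'
      (fun z => fderiv ℝ (piolaField F G) z (Pi.single j 1) j) := by
    intro j
    refine ((hPsa j).fderiv_apply_single hW'o (fun z hz => differentiableAt_pi.1 (hPd z hz) j)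
      j).congr fun z hz => ?_
    show fderiv ℝ (fun z => piolaField F G z j) z (Pi.single j 1) =
      fderiv ℝ (piolaField F G) z (Pi.single j 1) j
    rw [fderiv_apply (hPd z hz) j]
    rfl
  exact ⟨hW'sa, hPsa, hDsa⟩

end Summit.KontsevichZagierPeriods.KontsevichZagierPeriods.Cruxes.StokesGeneration.FibrewiseStokes

end
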